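import Summits.Ventures.PercRepro.SixThreeShares

/-!
# PercRepro — the `(7,3)` cell, (R6) part (b): the witness structure over a plane (night-3, gen 4)

`G` a plane, `K ⊆ E ∖ G` with `ρ(G ∪ K) = 7` (a basis of `E ∖ G` when `ρ(E ∖ G) = 7 − t`).  The witnesses of
`(R6)` are `B ∪ X`, `X ⊆ K` with `1 ≤ |X| ≤ 3`, and their shares depend on `ρ(G ∪ X) ∈ {4, 5, 6}` (mine-2 §26.1:
`π` parallel pairs `ρ(G ∪ X) = 4`, `τ₁` triples of rank `4`, `τ₂` triples of rank `5`).  This file: the rank calculus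
on `G ∪ X` (submodularity `submod_union`, the card bound `eRk_union_le_add_card`), a spanning `4`-subset `B₀ ⊆ K`
(`exists_four_spanning`), the free case (`eRk_union_eq_of_free`: every `X ⊆ B₀` has `ρ(G ∪ X) = 3 + |X|`), and the
local counts against `B₀` for a point `y ∉ B₀`: at most one `b ∈ B₀` parallel to `y` (`card_parallel_le_one`); if
`y ∥ b₁` every pair avoiding `b₁` gives a rank-`6` triple (`eRk_triple_eq_six_of_parallel`); if `y` is parallel to
no `b`, at most one pair gives a rank-`≤ 5` triple (`card_pairs_le_five_le_one`); hence at least `3` of the `6`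
pairs give rank `6` (`three_le_card_pairs_six`).  `SevenThreeWitnessStructureB.lean` assembles the global counts
(`π ≤ 3`, `τ₁ ≤ 1`, `τ₁ + τ₂ ≤ 10` at `|K| = 6`; `1 / 0 / 3` at `|K| = 5`; free at `|K| = 4`).  Axioms: standard.
-/

namespace PercRepro

namespace SevenThree

open Finset ThmH

variable {α : Type*} [DecidableEq α] {M : Matroid α} [M.Finite]

omit [M.Finite] in
/-- Submodularity along `G`: `ρ(G ∪ (X ∩ X′)) + ρ(G ∪ (X ∪ X′)) ≤ ρ(G ∪ X) + ρ(G ∪ X′)`. -/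
theorem submod_union (G X X' : Finset α) :
    M.eRk ((G ∪ (X ∩ X') : Finset α) : Set α) + M.eRk ((G ∪ (X ∪ X') : Finset α) : Set α) ≤
      M.eRk ((G ∪ X : Finset α) : Set α) + M.eRk ((G ∪ X' : Finset α) : Set α) := by
  have h := M.eRk_inter_add_eRk_union_le ((G ∪ X : Finset α) : Set α) ((G ∪ X' : Finset α) : Set α)
  rw [← Finset.coe_inter, ← Finset.coe_union] at h
  have h1 : (G ∪ X) ∩ (G ∪ X') = G ∪ (X ∩ X') := (Finset.union_inter_distrib_left G X X').symm
  have h2 : (G ∪ X) ∪ (G ∪ X') = G ∪ (X ∪ X') := by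
    ext y; simp only [Finset.mem_union]; tauto
  rw [h1, h2] at h
  exact h

omit [DecidableEq α] [M.Finite] in
/-- `ρ(Y) ≤ |Y|`. -/
theorem eRk_le_card' (Y : Finset α) : M.eRk (Y : Set α) ≤ (Y.card : ℕ∞) := by
  have h := M.eRk_le_encard (Y : Set α)
  rwa [Set.encard_coe_eq_coe_finsetCard] at h

omit [M.Finite] in
/-- `ρ(G ∪ Y) ≤ ρ(G ∪ X) + |Y ∖ X|`. -/
theorem eRk_union_le_add_card (G X Y : Finset α) :
    M.eRk ((G ∪ Y : Finset α) : Set α) ≤ M.eRk ((G ∪ X : Finset α) : Set α) + ((Y \ X).card : ℕ∞) := by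
  have hsub : G ∪ Y ⊆ (G ∪ X) ∪ (Y \ X) := by
    intro z hz
    rw [Finset.mem_union] at hz
    rw [Finset.mem_union, Finset.mem_union, Finset.mem_sdiff]
    rcases hz with hz | hz
    · exact Or.inl (Or.inl hz)
    · by_cases hzX : z ∈ X
      · exact Or.inl (Or.inr hzX)
      · exact Or.inr ⟨hz, hzX⟩
  calc M.eRk ((G ∪ Y : Finset α) : Set α) ≤ M.eRk (((G ∪ X) ∪ (Y \ X) : Finset α) : Set α) :=
        M.eRk_mono (Finset.coe_subset.2 hsub)
    _ ≤ M.eRk ((G ∪ X : Finset α) : Set α) + M.eRk ((Y \ X : Finset α) : Set α) := by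
        rw [Finset.coe_union]; exact M.eRk_union_le_eRk_add_eRk _ _
    _ ≤ M.eRk ((G ∪ X : Finset α) : Set α) + ((Y \ X).card : ℕ∞) := add_le_add (le_refl _) (eRk_le_card' _)

omit [M.Finite] in
/-- `ρ(G ∪ X) ≤ ρ(G) + |X|`. -/
theorem eRk_union_le_eRk_add_card (G X : Finset α) :
    M.eRk ((G ∪ X : Finset α) : Set α) ≤ M.eRk (G : Set α) + (X.card : ℕ∞) := by
  have h := eRk_union_le_add_card (M := M) G ∅ X
  rw [Finset.union_empty, Finset.sdiff_empty] at h
  exact h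

/-- A point off a plane spans rank `4` with it. -/
theorem eRk_union_singleton_eq_four {G : Finset α} (hG : G ∈ planes M) {y : α} (hy : y ∈ gr M) (hyG : y ∉ G) :
    M.eRk ((G ∪ {y} : Finset α) : Set α) = 4 := by
  rw [Finset.union_comm, Finset.singleton_union]
  exact eRk_insert_eq_four hG (Finset.Subset.refl G) (mem_planes.1 hG).2.2 hy hyG

/-- **A spanning `4`-subset.**  If `ρ(G ∪ K) = 7` for a plane `G` and `K ⊆ E ∖ G`, some `B₀ ⊆ K` with `|B₀| = 4`
has `ρ(G ∪ B₀) = 7` (a basis of `G ∪ K` through a basis of `G`, minus `G`). -/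
theorem exists_four_spanning {G K : Finset α} (hG : G ∈ planes M) (hK : K ⊆ gr M)
    (hr : M.eRk ((G ∪ K : Finset α) : Set α) = 7) :
    ∃ B₀ : Finset α, B₀ ⊆ K ∧ B₀.card = 4 ∧ M.eRk ((G ∪ B₀ : Finset α) : Set α) = 7 := by
  classical
  have hGE : (G : Set α) ⊆ M.E := by rw [← coe_gr M]; exact_mod_cast (mem_planes.1 hG).1
  have hGKE : ((G ∪ K : Finset α) : Set α) ⊆ M.E := by
    rw [← coe_gr M]; exact_mod_cast (Finset.union_subset (mem_planes.1 hG).1 hK)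
  obtain ⟨I, hI⟩ := M.exists_isBasis (G : Set α) hGE
  have hGsub : (G : Set α) ⊆ ((G ∪ K : Finset α) : Set α) := by
    rw [Finset.coe_union]; exact Set.subset_union_left
  obtain ⟨J, hJ, hJG⟩ := hI.exists_isBasis_inter_eq_of_superset hGsub hGKE
  have hJfin : J.Finite := (G ∪ K).finite_toSet.subset hJ.subset
  -- `|J| = 7`, `|J ∩ G| = |I| = 3`
  have hJcard : (hJfin.toFinset.card : ℕ∞) = 7 := by
    rw [← Set.Finite.encard_eq_coe_toFinset_card hJfin, hJ.encard_eq_eRk, hr]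
  have hIfin : I.Finite := G.finite_toSet.subset hI.subset
  have hIcard : (hIfin.toFinset.card : ℕ∞) = 3 := by
    rw [← Set.Finite.encard_eq_coe_toFinset_card hIfin, hI.encard_eq_eRk, (mem_planes.1 hG).2.2]
  set B₀ := hJfin.toFinset \ G with hB₀
  have hJG' : hJfin.toFinset ∩ G = hIfin.toFinset := by
    ext z
    rw [Finset.mem_inter, Set.Finite.mem_toFinset, Set.Finite.mem_toFinset, ← Finset.mem_coe, ← hJG]
    rfl
  refine ⟨B₀, ?_, ?_, ?_⟩
  · intro z hz
    rw [hB₀, Finset.mem_sdiff, Set.Finite.mem_toFinset] at hz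
    have := hJ.subset hz.1
    rw [Finset.mem_coe, Finset.mem_union] at this
    rcases this with h | h
    · exact absurd h hz.2
    · exact h
  · have h1 : (hJfin.toFinset \ G).card + (hJfin.toFinset ∩ G).card = hJfin.toFinset.card :=
      Finset.card_sdiff_add_card_inter _ _
    rw [hJG'] at h1
    have h7 : hJfin.toFinset.card = 7 := by exact_mod_cast hJcard
    have h3 : hIfin.toFinset.card = 3 := by exact_mod_cast hIcard
    rw [hB₀]
    omega
  · apply le_antisymm
    · rw [← hr]
      apply M.eRk_mono
      rw [Finset.coe_subset]
      apply Finset.union_subset_union (Finset.Subset.refl G)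
      intro z hz
      rw [hB₀, Finset.mem_sdiff, Set.Finite.mem_toFinset] at hz
      have := hJ.subset hz.1
      rw [Finset.mem_coe, Finset.mem_union] at this
      rcases this with h | h
      · exact absurd h hz.2
      · exact h
    · rw [← hr, ← hJ.eRk_eq_eRk]
      apply M.eRk_mono
      intro z hz
      have hz' : z ∈ hJfin.toFinset := by rw [Set.Finite.mem_toFinset]; exact hz
      rw [Finset.mem_coe, Finset.mem_union]
      by_cases hzG : z ∈ G
      · exact Or.inl hzG
      · right
        rw [hB₀, Finset.mem_sdiff]
        exact ⟨hz', hzG⟩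

/-- **The free case.**  If `ρ(G ∪ B₀) = 7` with `|B₀| = 4` and `ρ(G) = 3`, every `X ⊆ B₀` has `ρ(G ∪ X) = 3 + |X|`. -/
theorem eRk_union_eq_of_free {G B₀ : Finset α} (hG3 : M.eRk (G : Set α) = 3) (hB₀ : B₀.card = 4)
    (hr : M.eRk ((G ∪ B₀ : Finset α) : Set α) = 7) {X : Finset α} (hX : X ⊆ B₀) :
    M.eRk ((G ∪ X : Finset α) : Set α) = ((3 + X.card : ℕ) : ℕ∞) := by
  have hup := eRk_union_le_eRk_add_card (M := M) G X
  rw [hG3] at hup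
  have hlow := eRk_union_le_add_card (M := M) G X B₀
  rw [hr, Finset.card_sdiff, Finset.inter_eq_left.2 hX, hB₀] at hlow
  obtain ⟨k, hk, -⟩ := eRk_eq_nat M (G ∪ X)
  rw [hk] at hup hlow ⊢
  have hXc : X.card ≤ 4 := by rw [← hB₀]; exact Finset.card_le_card hX
  have hup' : k ≤ 3 + X.card := by exact_mod_cast hup
  have hlow' : 7 ≤ k + (4 - X.card) := by exact_mod_cast hlow
  exact_mod_cast (show k = 3 + X.card by omega)

/-- Two points of `B₀` are never parallel over `G`: `ρ(G ∪ {b, b′}) = 5`. -/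
theorem eRk_pair_eq_five_of_free {G B₀ : Finset α} (hG3 : M.eRk (G : Set α) = 3) (hB₀ : B₀.card = 4)
    (hr : M.eRk ((G ∪ B₀ : Finset α) : Set α) = 7) {b b' : α} (hb : b ∈ B₀) (hb' : b' ∈ B₀) (hbb' : b ≠ b') :
    M.eRk ((G ∪ {b, b'} : Finset α) : Set α) = 5 := by
  have h := eRk_union_eq_of_free hG3 hB₀ hr (X := {b, b'}) (by
    intro z hz
    rw [Finset.mem_insert, Finset.mem_singleton] at hz
    rcases hz with rfl | rfl <;> assumption)
  rw [Finset.card_pair hbb'] at h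
  exact h

/-- Three points of `B₀` span rank `6` over `G`. -/
theorem eRk_triple_eq_six_of_free {G B₀ : Finset α} (hG3 : M.eRk (G : Set α) = 3) (hB₀ : B₀.card = 4)
    (hr : M.eRk ((G ∪ B₀ : Finset α) : Set α) = 7) {T : Finset α} (hT : T ⊆ B₀) (hT3 : T.card = 3) :
    M.eRk ((G ∪ T : Finset α) : Set α) = 6 := by
  have h := eRk_union_eq_of_free hG3 hB₀ hr hT
  rw [hT3] at h
  exact h

/-- A point `y ∉ G` is parallel over `G` to at most one point of a free `B₀`: if `ρ(G ∪ {y, b}) = 4 = ρ(G ∪ {y, b′})`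
with `b ≠ b′ ∈ B₀`, submodularity gives `ρ(G ∪ {y, b, b′}) ≤ 4 < 5 = ρ(G ∪ {b, b′})`. -/
theorem not_parallel_two {G B₀ : Finset α} (hG : G ∈ planes M) (hB₀ : B₀.card = 4)
    (hr : M.eRk ((G ∪ B₀ : Finset α) : Set α) = 7) {y : α} (hy : y ∈ gr M) (hyG : y ∉ G)
    {b b' : α} (hb : b ∈ B₀) (hb' : b' ∈ B₀) (hbb' : b ≠ b')
    (h1 : M.eRk ((G ∪ {y, b} : Finset α) : Set α) = 4) (h2 : M.eRk ((G ∪ {y, b'} : Finset α) : Set α) = 4) :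
    False := by
  have hG3 := (mem_planes.1 hG).2.2
  have hsm := submod_union (M := M) G {y, b} {y, b'}
  have hinter : ({y, b} : Finset α) ∩ {y, b'} = {y} := by
    ext z
    simp only [Finset.mem_inter, Finset.mem_insert, Finset.mem_singleton]
    constructor
    · rintro ⟨rfl | rfl, h⟩
      · rfl
      · rcases h with h | h
        · exact h
        · exact absurd h hbb'
    · rintro rfl
      exact ⟨Or.inl rfl, Or.inl rfl⟩
  rw [hinter, h1, h2, eRk_union_singleton_eq_four hG hy hyG] at hsm
  have h5 := eRk_pair_eq_five_of_free hG3 hB₀ hr hb hb' hbb'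
  have hmono : M.eRk ((G ∪ {b, b'} : Finset α) : Set α) ≤ M.eRk ((G ∪ ({y, b} ∪ {y, b'}) : Finset α) : Set α) := by
    apply M.eRk_mono
    rw [Finset.coe_subset]
    apply Finset.union_subset_union (Finset.Subset.refl G)
    intro z hz
    rw [Finset.mem_insert, Finset.mem_singleton] at hz
    rw [Finset.mem_union, Finset.mem_insert, Finset.mem_singleton, Finset.mem_insert, Finset.mem_singleton]
    rcases hz with rfl | rfl
    · exact Or.inl (Or.inr rfl)
    · exact Or.inr (Or.inr rfl)
  rw [h5] at hmono
  have : (4 : ℕ∞) + 5 ≤ 4 + 4 := (add_le_add (le_refl _) hmono).trans hsm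
  exact absurd this (by decide)

/-- At most one point of `B₀` is parallel over `G` to a given `y ∉ G`. -/
theorem card_parallel_le_one {G B₀ : Finset α} (hG : G ∈ planes M) (hB₀ : B₀.card = 4)
    (hr : M.eRk ((G ∪ B₀ : Finset α) : Set α) = 7) {y : α} (hy : y ∈ gr M) (hyG : y ∉ G) :
    (B₀.filter (fun b => M.eRk ((G ∪ {y, b} : Finset α) : Set α) = 4)).card ≤ 1 := by
  rw [Finset.card_le_one]
  intro b hb b' hb'
  rw [Finset.mem_filter] at hb hb'
  by_contra hne
  exact not_parallel_two hG hB₀ hr hy hyG hb.1 hb'.1 hne hb.2 hb'.2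

/-- If `y ∥ b₁` over `G` (`ρ(G ∪ {y, b₁}) = 4`) then for `b ≠ b′ ∈ B₀ ∖ {b₁}` the triple `{y, b, b′}` has rank `6`:
`b₁ ∈ cl(G ∪ y)`, so `G ∪ {y, b, b′}` spans `G ∪ {b₁, b, b′}`. -/
theorem eRk_triple_eq_six_of_parallel {G B₀ : Finset α} (hG : G ∈ planes M) (hB₀ : B₀.card = 4)
    (hr : M.eRk ((G ∪ B₀ : Finset α) : Set α) = 7) {y : α} (hy : y ∈ gr M) (hyG : y ∉ G) (hyB : y ∉ B₀)
    {b₁ b b' : α} (hb₁ : b₁ ∈ B₀) (hb : b ∈ B₀) (hb' : b' ∈ B₀) (hbb' : b ≠ b') (hb₁b : b₁ ≠ b) (hb₁b' : b₁ ≠ b')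
    (hpar : M.eRk ((G ∪ {y, b₁} : Finset α) : Set α) = 4) :
    M.eRk ((G ∪ {y, b, b'} : Finset α) : Set α) = 6 := by
  have hG3 := (mem_planes.1 hG).2.2
  have hyb : y ≠ b := fun h => hyB (h ▸ hb)
  have hyb' : y ≠ b' := fun h => hyB (h ▸ hb')
  have hyb₁ : y ≠ b₁ := fun h => hyB (h ▸ hb₁)
  apply le_antisymm
  · have h := eRk_union_le_eRk_add_card (M := M) G {y, b, b'}
    rw [hG3] at h
    have hc : ({y, b, b'} : Finset α).card ≤ 3 := Finset.card_le_three
    exact h.trans (by exact_mod_cast (show 3 + ({y, b, b'} : Finset α).card ≤ 6 by omega))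
  · -- submodularity of `G ∪ {y, b₁}` and `G ∪ {y, b, b′}`
    have hsm := submod_union (M := M) G {y, b₁} {y, b, b'}
    have hinter : ({y, b₁} : Finset α) ∩ {y, b, b'} = {y} := by
      ext z
      simp only [Finset.mem_inter, Finset.mem_insert, Finset.mem_singleton]
      constructor
      · rintro ⟨rfl | rfl, h⟩
        · rfl
        · rcases h with h | h | h
          · exact absurd h.symm hyb₁
          · exact absurd h hb₁b
          · exact absurd h hb₁b'
      · rintro rfl
        exact ⟨Or.inl rfl, Or.inl rfl⟩
    rw [hinter, hpar, eRk_union_singleton_eq_four hG hy hyG] at hsm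
    have h6 : M.eRk ((G ∪ {b₁, b, b'} : Finset α) : Set α) = 6 := by
      apply eRk_triple_eq_six_of_free hG3 hB₀ hr
      · intro z hz
        simp only [Finset.mem_insert, Finset.mem_singleton] at hz
        rcases hz with rfl | rfl | rfl <;> assumption
      · rw [Finset.card_insert_of_notMem, Finset.card_pair hbb']
        simp only [Finset.mem_insert, Finset.mem_singleton]
        push Not
        exact ⟨hb₁b, hb₁b'⟩
    have hmono : M.eRk ((G ∪ {b₁, b, b'} : Finset α) : Set α) ≤
        M.eRk ((G ∪ ({y, b₁} ∪ {y, b, b'}) : Finset α) : Set α) := by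
      apply M.eRk_mono
      rw [Finset.coe_subset]
      apply Finset.union_subset_union (Finset.Subset.refl G)
      intro z hz
      simp only [Finset.mem_insert, Finset.mem_singleton] at hz
      simp only [Finset.mem_union, Finset.mem_insert, Finset.mem_singleton]
      rcases hz with rfl | rfl | rfl
      · exact Or.inl (Or.inr rfl)
      · exact Or.inr (Or.inr (Or.inl rfl))
      · exact Or.inr (Or.inr (Or.inr rfl))
    rw [h6] at hmono
    have h : (4 : ℕ∞) + 6 ≤ 4 + M.eRk ((G ∪ {y, b, b'} : Finset α) : Set α) :=
      (add_le_add (le_refl _) hmono).trans hsm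
    exact (ENat.add_le_add_iff_left (by decide)).1 h

/-- A triple `{y} ∪ p` (`p ⊆ B₀` a pair) has rank `≤ 6` over `G`; rank `≠ 6` means rank `≤ 5`. -/
theorem eRk_triple_le_six {G B₀ : Finset α} (hG3 : M.eRk (G : Set α) = 3) {y : α} {p : Finset α}
    (hp : p ∈ B₀.powersetCard 2) :
    M.eRk ((G ∪ insert y p : Finset α) : Set α) ≤ 6 ∧
    (M.eRk ((G ∪ insert y p : Finset α) : Set α) ≠ 6 → M.eRk ((G ∪ insert y p : Finset α) : Set α) ≤ 5) := by
  have h := eRk_union_le_eRk_add_card (M := M) G (insert y p)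
  rw [hG3] at h
  have hc : (insert y p).card ≤ 3 := by
    have := Finset.card_insert_le y p
    have := (Finset.mem_powersetCard.1 hp).2
    omega
  have h6 : M.eRk ((G ∪ insert y p : Finset α) : Set α) ≤ 6 :=
    h.trans (by exact_mod_cast (show 3 + (insert y p).card ≤ 6 by omega))
  refine ⟨h6, fun hne => ?_⟩
  obtain ⟨k, hk, -⟩ := eRk_eq_nat M (G ∪ insert y p)
  rw [hk] at h6 hne ⊢
  have hk6 : k ≤ 6 := by exact_mod_cast h6
  have hk6' : k ≠ 6 := fun h => hne (by rw [h]; rfl)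
  exact_mod_cast (show k ≤ 5 by omega)

/-- If `y ∉ B₀` is parallel over `G` to no point of `B₀`, at most one pair `p ⊆ B₀` gives a triple `{y} ∪ p` of rank
`≤ 5`: two such pairs sharing `b` force `ρ(G ∪ {y, b}) ≤ 4`, two disjoint ones force `ρ(G ∪ {y}) ≤ 3`. -/
theorem card_pairs_le_five_le_one {G B₀ : Finset α} (hG : G ∈ planes M) (hB₀ : B₀.card = 4)
    (hr : M.eRk ((G ∪ B₀ : Finset α) : Set α) = 7) {y : α} (hy : y ∈ gr M) (hyG : y ∉ G)
    (hnopar : ∀ b ∈ B₀, M.eRk ((G ∪ {y, b} : Finset α) : Set α) ≠ 4) :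
    ((B₀.powersetCard 2).filter (fun p => M.eRk ((G ∪ insert y p : Finset α) : Set α) ≤ 5)).card ≤ 1 := by
  have hG3 := (mem_planes.1 hG).2.2
  rw [Finset.card_le_one]
  intro p hp p' hp'
  rw [Finset.mem_filter, Finset.mem_powersetCard] at hp hp'
  by_contra hne
  -- `|p ∩ p′| ≤ 1`, `|p ∪ p′| = 4 − |p ∩ p′|`
  have hinter1 : (p ∩ p').card ≤ 1 := by
    by_contra h
    push Not at h
    have hle : p.card ≤ (p ∩ p').card := by rw [hp.1.2]; exact h
    have hpp' : p ⊆ p' := by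
      have := Finset.eq_of_subset_of_card_le Finset.inter_subset_left hle
      rw [← this]; exact Finset.inter_subset_right
    exact hne (Finset.eq_of_subset_of_card_le hpp' (by rw [hp.1.2, hp'.1.2]))
  have hunion : (p ∪ p').card + (p ∩ p').card = 4 := by
    rw [Finset.card_union_add_card_inter, hp.1.2, hp'.1.2]
  have hsm := submod_union (M := M) G (insert y p) (insert y p')
  have hi : insert y p ∩ insert y p' = insert y (p ∩ p') := by
    ext z; simp only [Finset.mem_inter, Finset.mem_insert]; tauto
  have hu : insert y p ∪ insert y p' = insert y (p ∪ p') := by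
    ext z; simp only [Finset.mem_union, Finset.mem_insert]; tauto
  rw [hi, hu] at hsm
  -- the union part has rank `≥ 3 + |p ∪ p′|`
  have hfree := eRk_union_eq_of_free hG3 hB₀ hr (Finset.union_subset hp.1.1 hp'.1.1)
  have hlow : M.eRk ((G ∪ (p ∪ p') : Finset α) : Set α) ≤ M.eRk ((G ∪ insert y (p ∪ p') : Finset α) : Set α) := by
    apply M.eRk_mono
    rw [Finset.coe_subset]
    exact Finset.union_subset_union (Finset.Subset.refl G) (Finset.subset_insert y _)
  rw [hfree] at hlow
  have hsum : M.eRk ((G ∪ insert y (p ∩ p') : Finset α) : Set α) + ((3 + (p ∪ p').card : ℕ) : ℕ∞) ≤ 5 + 5 :=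
    (add_le_add (le_refl _) hlow).trans (hsm.trans (add_le_add hp.2 hp'.2))
  rcases (show (p ∩ p').card = 0 ∨ (p ∩ p').card = 1 by omega) with h0 | h1
  · -- disjoint pairs: `ρ(G ∪ {y}) ≤ 3`
    have hpp : p ∩ p' = ∅ := Finset.card_eq_zero.1 h0
    have hc4 : (p ∪ p').card = 4 := by omega
    rw [hpp, Finset.insert_empty, eRk_union_singleton_eq_four hG hy hyG, hc4] at hsum
    exact absurd hsum (by decide)
  · -- pairs sharing `b`: `ρ(G ∪ {y, b}) ≤ 4`, but `y ∦ b` and `ρ(G ∪ {y, b}) ≥ 4`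
    obtain ⟨b, hb⟩ := Finset.card_eq_one.1 h1
    have hbB : b ∈ B₀ := hp.1.1 (Finset.mem_inter.1 (hb ▸ Finset.mem_singleton_self b)).1
    have hc3 : (p ∪ p').card = 3 := by omega
    rw [hb, hc3] at hsum
    have h4 : (4 : ℕ∞) ≤ M.eRk ((G ∪ insert y {b} : Finset α) : Set α) := by
      rw [← eRk_union_singleton_eq_four hG hy hyG]
      apply M.eRk_mono
      rw [Finset.coe_subset]
      exact Finset.union_subset_union (Finset.Subset.refl G) (Finset.singleton_subset_iff.2 (Finset.mem_insert_self y _))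
    have hne4 : M.eRk ((G ∪ insert y {b} : Finset α) : Set α) ≠ 4 := hnopar b hbB
    obtain ⟨k, hk, -⟩ := eRk_eq_nat M (G ∪ insert y {b})
    rw [hk] at hsum h4 hne4
    have hk4 : 4 ≤ k := by exact_mod_cast h4
    have hk4' : k ≠ 4 := fun h => hne4 (by rw [h]; rfl)
    have hk5 : (5 : ℕ∞) ≤ (k : ℕ∞) := by exact_mod_cast (show 5 ≤ k by omega)
    have : (5 : ℕ∞) + ((3 + 3 : ℕ) : ℕ∞) ≤ 5 + 5 := (add_le_add hk5 (le_refl _)).trans hsum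
    exact absurd this (by decide)

/-- **At least three of the six pairs of `B₀` give a rank-`6` triple with `y`.** -/
theorem three_le_card_pairs_six {G B₀ : Finset α} (hG : G ∈ planes M) (hB₀ : B₀.card = 4)
    (hr : M.eRk ((G ∪ B₀ : Finset α) : Set α) = 7) {y : α} (hy : y ∈ gr M) (hyG : y ∉ G) (hyB : y ∉ B₀) :
    3 ≤ ((B₀.powersetCard 2).filter (fun p => M.eRk ((G ∪ insert y p : Finset α) : Set α) = 6)).card := by
  classical
  have hG3 := (mem_planes.1 hG).2.2
  by_cases hpar : ∃ b₁ ∈ B₀, M.eRk ((G ∪ {y, b₁} : Finset α) : Set α) = 4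
  · obtain ⟨b₁, hb₁, hpar⟩ := hpar
    -- the three pairs avoiding `b₁`
    have hsub : (B₀.erase b₁).powersetCard 2 ⊆
        (B₀.powersetCard 2).filter (fun p => M.eRk ((G ∪ insert y p : Finset α) : Set α) = 6) := by
      intro p hp
      rw [Finset.mem_powersetCard] at hp
      rw [Finset.mem_filter, Finset.mem_powersetCard]
      refine ⟨⟨hp.1.trans (Finset.erase_subset b₁ B₀), hp.2⟩, ?_⟩
      obtain ⟨b, b', hbb', rfl⟩ := Finset.card_eq_two.1 hp.2
      have hb : b ∈ B₀.erase b₁ := hp.1 (Finset.mem_insert_self b {b'})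
      have hb' : b' ∈ B₀.erase b₁ := hp.1 (Finset.mem_insert_of_mem (Finset.mem_singleton_self b'))
      rw [Finset.mem_erase] at hb hb'
      exact eRk_triple_eq_six_of_parallel hG hB₀ hr hy hyG hyB hb₁ hb.2 hb'.2 hbb' (Ne.symm hb.1) (Ne.symm hb'.1) hpar
    calc 3 = ((B₀.erase b₁).powersetCard 2).card := by
          rw [Finset.card_powersetCard, Finset.card_erase_of_mem hb₁, hB₀]; decide
      _ ≤ _ := Finset.card_le_card hsub
  · push Not at hpar
    -- at most one pair is bad
    have hbad := card_pairs_le_five_le_one hG hB₀ hr hy hyG hpar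
    have hsplit := Finset.card_filter_add_card_filter_not (s := B₀.powersetCard 2)
      (p := fun p => M.eRk ((G ∪ insert y p : Finset α) : Set α) = 6)
    have hsub : (B₀.powersetCard 2).filter (fun p => ¬ M.eRk ((G ∪ insert y p : Finset α) : Set α) = 6) ⊆
        (B₀.powersetCard 2).filter (fun p => M.eRk ((G ∪ insert y p : Finset α) : Set α) ≤ 5) := by
      intro p hp
      rw [Finset.mem_filter] at hp ⊢
      exact ⟨hp.1, (eRk_triple_le_six hG3 hp.1).2 hp.2⟩
    have h6 : (B₀.powersetCard 2).card = 6 := by rw [Finset.card_powersetCard, hB₀]; decide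
    have := Finset.card_le_card hsub
    omega

end SevenThree

end PercRepro
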